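import Literature.MathematicalPhysics.QuantumLattice.OverlapIndexTrace
import Literature.MathematicalPhysics.QuantumLattice.OverlapKernelTools
import Mathlib.LinearAlgebra.Lagrange
import HarnessLib

/-!
# The lattice index theorem for the overlap operator (Hasenfratz–Laliena–Niedermayer, Lüscher 1998)

Topic `Literature/MathematicalPhysics/QuantumLattice`; namespace `Literature.MathematicalPhysics.QuantumLattice`.
Step (E) of the printed proof of the finite-volume index formula `IOSFluxSectorIndex` ([IgarashiOkuyamaSuzuki2002, (2.3)]:
"a lattice analogue of the analytic index theorem, `Σ_{x∈Γ} 𝒜(x) = n₊ − n₋`, which follows from the algebraic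
(Ginsparg–Wilson) relation alone"), proved here as finite-dimensional linear algebra for Neuberger's operator in the
tree's vocabulary (`OverlapDirac.lean`: `D₀ = overlapDirac ρ U m₀ 0 = 1 + Γ₅ ε(H)`, `ε(H) = cfc sign H`, `H = overlapKernel`):

* abstract form (`trace_mul_one_sub_half_ginspargWilson_eq_index`): for Hermitian involutions `Γ`, `ε` on `ℂⁿ` and
  `D₀ = 1 + Γε`, **`Tr Γ(1 − ½D₀) = n₊ − n₋`** with `n_± = dim (ker D₀ ∩ ker (Γ ∓ 1))`.  Proof: with `X = Γ − ε`,
  `Y = Γ + ε` one has `Γ(1 − ½D₀) = ½X`, `XY = −YX`, `Y² = 4 − X²`; cyclicity gives `Tr (X g(X²) Y²) = 0` for every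
  polynomial `g` (`trace_mul_aeval_sq_mul_sq_eq_zero`); choosing `g` by Lagrange interpolation with `g(s) = 1/(4 − s)` on the
  squares `≠ 4` of the eigenvalues of `X` shows `Tr X = 2 #{λ = 2} − 2 #{λ = −2}` (`trace_sub_eq_of_involutions`);
  multiplicities are nullities (`card_filter_eigenvalues_eq_finrank_ker`, spectral theorem + `rank_diagonal`); and
  `ker (X ∓ 2) = ker D₀ ∩ ker (Γ ∓ 1)` (`ker_involution_diff_eq`, from the norm identity
  `‖(Γ−σ)ψ‖² + ‖(ε+σ)ψ‖² = Re⟨ψ,(4 − 2σX)ψ⟩`);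
* `overlap_index_theorem` — the statement for `overlapDirac ρ U m₀ 0` off the exceptional set `det H = 0` (unitary `ρ`);
* `overlap_index_eq_countP_neg_sub_half` — combined with `trace_gammaFive_mul_one_sub_half_overlapDirac_zero`
  (`OverlapIndexTrace.lean`): **`n₊ − n₋ = N₋(H) − ½ dim`** [Fujiwara2002SpectralFlow, (2.2)].

No definitions, no named facts.

## References
* P. Hasenfratz, V. Laliena, F. Niedermayer, *The index theorem in QCD with a finite cut-off*, Phys. Lett. B 427 (1998) 125,
  arXiv:hep-lat/9801021, eq. (11). [HasenfratzLalienaNiedermayer1998]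
* M. Lüscher, Phys. Lett. B 428 (1998) 342, arXiv:hep-lat/9802011. [Luscher1998]
* T. Fujiwara, Prog. Theor. Phys. 107 (2002) 163, eq. (2.2). [Fujiwara2002SpectralFlow]
* H. Igarashi, K. Okuyama, H. Suzuki, Nucl. Phys. B 644 (2002) 383, (2.3). [IgarashiOkuyamaSuzuki2002]
-/

noncomputable section

open Matrix Finset Polynomial
open Literature.Probability.LatticeModels (TorusSite)
open Literature.MathematicalPhysics.QuantumFieldTheory

namespace Literature.MathematicalPhysics.QuantumLattice

section Abstract

variable {n : Type*} [Fintype n] [DecidableEq n]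

/-- The trace of a real polynomial in a Hermitian matrix is the sum of its values at the eigenvalues. [folklore] -/
theorem trace_aeval_of_isHermitian {A : Matrix n n ℂ} (hA : A.IsHermitian) (q : ℝ[X]) :
    (aeval A q).trace = ∑ i, ((q.eval (hA.eigenvalues i) : ℝ) : ℂ) := by
  rw [← cfc_polynomial q A hA.isSelfAdjoint, hA.cfc_eq, Matrix.IsHermitian.cfc,
    Unitary.conjStarAlgAut_apply, trace_unitary_conj hA.eigenvectorUnitary.2, Matrix.trace_diagonal]
  simp only [Function.comp_apply]
  rfl

/-- The eigenvector unitary has invertible determinant. [folklore] -/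
theorem isUnit_det_of_mem_unitaryGroup {U : Matrix n n ℂ} (hU : U ∈ Matrix.unitaryGroup n ℂ) :
    IsUnit U.det := by
  have h : U * star U = 1 := Matrix.mem_unitaryGroup_iff.mp hU
  have hdet := congrArg Matrix.det h
  rw [Matrix.det_mul, Matrix.det_one] at hdet
  exact isUnit_iff_ne_zero.mpr (left_ne_zero_of_mul_eq_one hdet)

/-- **Multiplicity = nullity** for a Hermitian matrix: the number of indices `i` with `λ_i = c` is the
dimension of `ker (A − c)`. [folklore] -/
theorem card_filter_eigenvalues_eq_finrank_ker {A : Matrix n n ℂ} (hA : A.IsHermitian) (c : ℝ) :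
    (Finset.univ.filter fun i => hA.eigenvalues i = c).card =
      Module.finrank ℂ (LinearMap.ker (A - ((c : ℝ) : ℂ) • (1 : Matrix n n ℂ)).mulVecLin) := by
  classical
  set U : Matrix n n ℂ := (hA.eigenvectorUnitary : Matrix n n ℂ) with hUdef
  have hU : U ∈ Matrix.unitaryGroup n ℂ := hA.eigenvectorUnitary.2
  have hUU : star U * U = 1 := Matrix.mem_unitaryGroup_iff'.mp hU
  have hUU' : U * star U = 1 := Matrix.mem_unitaryGroup_iff.mp hU
  -- A − c = U diag(λ − c) U⋆
  have hB : A - ((c : ℝ) : ℂ) • (1 : Matrix n n ℂ) =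
      U * diagonal (fun i => (((hA.eigenvalues i - c : ℝ)) : ℂ)) * star U := by
    have hspec : A = U * diagonal (RCLike.ofReal ∘ hA.eigenvalues) * star U := by
      conv_lhs => rw [hA.spectral_theorem]
      rw [Unitary.conjStarAlgAut_apply]
    have hdiag : diagonal (fun i => (((hA.eigenvalues i - c : ℝ)) : ℂ)) =
        diagonal (RCLike.ofReal ∘ hA.eigenvalues) - ((c : ℝ) : ℂ) • (1 : Matrix n n ℂ) := by
      ext i j
      simp only [diagonal_apply, Matrix.sub_apply, Matrix.smul_apply, Matrix.one_apply, Function.comp_apply,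
        smul_eq_mul, mul_ite, mul_one, mul_zero]
      split_ifs with hij
      · push_cast; rfl
      · rw [sub_zero]
    rw [hdiag, Matrix.mul_sub, Matrix.sub_mul, ← hspec, Matrix.mul_smul, Matrix.mul_one,
      Matrix.smul_mul, hUU']
  -- rank
  have hrank : (A - ((c : ℝ) : ℂ) • (1 : Matrix n n ℂ)).rank =
      Fintype.card {i // hA.eigenvalues i ≠ c} := by
    rw [hB, Matrix.rank_mul_eq_left_of_isUnit_det (star U) _
      (by rw [star_eq_conjTranspose, det_conjTranspose]; exact (isUnit_det_of_mem_unitaryGroup hU).star),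
      Matrix.rank_mul_eq_right_of_isUnit_det U _ (isUnit_det_of_mem_unitaryGroup hU), Matrix.rank_diagonal]
    refine Fintype.card_congr (Equiv.subtypeEquivRight fun i => ?_)
    rw [ne_eq, ← Complex.ofReal_zero, Complex.ofReal_inj, sub_eq_zero]
  -- rank–nullity
  have hrn := LinearMap.finrank_range_add_finrank_ker (A - ((c : ℝ) : ℂ) • (1 : Matrix n n ℂ)).mulVecLin
  rw [Module.finrank_fintype_fun_eq_card] at hrn
  have hrank' : Module.finrank ℂ (LinearMap.range (A - ((c : ℝ) : ℂ) • (1 : Matrix n n ℂ)).mulVecLin) =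
      Fintype.card {i // hA.eigenvalues i ≠ c} := hrank
  have hsplit : Fintype.card {i // hA.eigenvalues i ≠ c} + Fintype.card {i // hA.eigenvalues i = c} =
      Fintype.card n := by
    rw [Fintype.card_subtype_compl, Nat.sub_add_cancel (Fintype.card_subtype_le _)]
  rw [Fintype.card_subtype] at hsplit
  rw [Fintype.card_subtype] at hsplit hrank'
  omega

/-- A matrix commuting with `M` commutes with every polynomial in `M`. [folklore] -/
theorem mul_aeval_comm {Y M : Matrix n n ℂ} (h : Y * M = M * Y) (g : ℝ[X]) :
    Y * aeval M g = aeval M g * Y := by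
  rw [aeval_eq_sum_range, Finset.mul_sum, Finset.sum_mul]
  refine Finset.sum_congr rfl fun i _ => ?_
  rw [Matrix.mul_smul, Matrix.smul_mul, ((show Commute Y M from h).pow_right i).eq]

/-- If `X Y = −Y X` then `Tr (X g(X²) Y²) = 0` for every polynomial `g` (cyclicity of the trace). [folklore] -/
theorem trace_mul_aeval_sq_mul_sq_eq_zero {X Y : Matrix n n ℂ} (h : X * Y = -(Y * X)) (g : ℝ[X]) :
    (X * aeval (X * X) g * (Y * Y)).trace = 0 := by
  have hYX : Y * X = -(X * Y) := by rw [h, neg_neg]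
  have hc : Y * (X * X) = X * X * Y := by
    conv_lhs => rw [← Matrix.mul_assoc, hYX, neg_mul, Matrix.mul_assoc, hYX, mul_neg, neg_neg,
      ← Matrix.mul_assoc]
  have hcP : Y * aeval (X * X) g = aeval (X * X) g * Y := mul_aeval_comm hc g
  set A := X * aeval (X * X) g with hA
  have hanti : Y * A = -(A * Y) := by
    rw [hA, ← Matrix.mul_assoc, hYX, neg_mul, neg_inj, Matrix.mul_assoc, hcP, Matrix.mul_assoc]
  have ht : (A * (Y * Y)).trace = -(A * (Y * Y)).trace := by
    conv_lhs => rw [← Matrix.mul_assoc, Matrix.trace_mul_comm, ← Matrix.mul_assoc, hanti, neg_mul,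
      Matrix.trace_neg, Matrix.mul_assoc]
  have h2 : (2 : ℂ) * (A * (Y * Y)).trace = 0 := by linear_combination ht
  exact (mul_eq_zero.mp h2).resolve_left two_ne_zero

/-- **Two anticommuting involutions**: for Hermitian involutions `Γ`, `ε` put `X = Γ − ε`, `Y = Γ + ε`; then
`Tr X = 2 dim ker(X − 2) − 2 dim ker(X + 2)` (eigenvalues `μ` of `X` with `μ² ≠ 4` cancel in pairs, because `Y`
anticommutes with `X` and `Y² = 4 − X²`). [folklore] -/
theorem trace_sub_eq_of_involutions {Γ ε : Matrix n n ℂ} (hΓ : Γᴴ = Γ) (hΓ2 : Γ * Γ = 1) (hε : εᴴ = ε)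
    (hε2 : ε * ε = 1) :
    (Γ - ε).trace =
      2 * (Module.finrank ℂ (LinearMap.ker (Γ - ε - ((2 : ℝ) : ℂ) • (1 : Matrix n n ℂ)).mulVecLin) : ℂ) -
      2 * (Module.finrank ℂ (LinearMap.ker (Γ - ε - ((-2 : ℝ) : ℂ) • (1 : Matrix n n ℂ)).mulVecLin) : ℂ) := by
  classical
  set X : Matrix n n ℂ := Γ - ε with hXdef
  set Y : Matrix n n ℂ := Γ + ε with hYdef
  have hX : X.IsHermitian := by
    show (Γ - ε)ᴴ = Γ - ε
    rw [conjTranspose_sub, hΓ, hε]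
  have hXY : X * Y = -(Y * X) := by
    simp only [hXdef, hYdef, Matrix.sub_mul, Matrix.mul_sub, Matrix.add_mul, Matrix.mul_add, hΓ2, hε2]
    abel
  have h4 : ((4 : ℝ) • (1 : Matrix n n ℂ)) = (1 + 1) + (1 + 1) := by
    rw [show (4 : ℝ) = 2 + 2 by norm_num, add_smul, two_smul]
  have hYY : Y * Y = (4 : ℝ) • (1 : Matrix n n ℂ) - X * X := by
    rw [h4]
    simp only [hXdef, hYdef, Matrix.sub_mul, Matrix.mul_sub, Matrix.add_mul, Matrix.mul_add, hΓ2, hε2]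
    abel
  -- the interpolating polynomial `g(s) = 1/(4 − s)` on the squares of the eigenvalues different from `4`
  set T : Finset ℝ := (Finset.univ.image fun i => hX.eigenvalues i ^ 2).filter (· ≠ 4) with hTdef
  set g : ℝ[X] := Lagrange.interpolate T id (fun s => (4 - s)⁻¹) with hgdef
  have hg : ∀ i, hX.eigenvalues i ^ 2 ≠ 4 → g.eval (hX.eigenvalues i ^ 2) = (4 - hX.eigenvalues i ^ 2)⁻¹ := by
    intro i hi
    have hmem : hX.eigenvalues i ^ 2 ∈ T := by
      rw [hTdef, Finset.mem_filter]
      exact ⟨Finset.mem_image.mpr ⟨i, Finset.mem_univ _, rfl⟩, hi⟩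
    have := Lagrange.eval_interpolate_at_node (fun s => (4 - s)⁻¹) (Set.injOn_id _) hmem
    exact this
  -- `p(μ) = μ g(μ²)(4 − μ²)` vanishes at `±2` and equals `μ` at the other eigenvalues
  set p : ℝ[X] := Polynomial.X * g.comp (Polynomial.X ^ 2) * (C 4 - Polynomial.X ^ 2) with hpdef
  have hp_eval : ∀ i, p.eval (hX.eigenvalues i) =
      if hX.eigenvalues i ^ 2 = 4 then 0 else hX.eigenvalues i := by
    intro i
    simp only [hpdef, eval_mul, eval_X, eval_comp, eval_pow, eval_sub, eval_C]
    split_ifs with h4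
    · rw [h4, sub_self, mul_zero]
    · rw [hg i h4]
      field_simp [sub_ne_zero.mpr (Ne.symm h4)]
  have hp_aeval : aeval X p = X * aeval (X * X) g * (Y * Y) := by
    simp only [hpdef, map_mul, map_sub, aeval_X, aeval_C, map_pow, hYY, Algebra.algebraMap_eq_smul_one]
    rw [aeval_comp, map_pow, aeval_X, sq]
  -- trace identities
  have htr0 : (aeval X p).trace = 0 := by
    rw [hp_aeval]; exact trace_mul_aeval_sq_mul_sq_eq_zero hXY g
  rw [trace_aeval_of_isHermitian hX] at htr0
  have htrX : X.trace = ∑ i, ((hX.eigenvalues i : ℝ) : ℂ) := hX.trace_eq_sum_eigenvalues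
  -- counting
  rw [← card_filter_eigenvalues_eq_finrank_ker hX 2, ← card_filter_eigenvalues_eq_finrank_ker hX (-2), htrX]
  have hsum : ∑ i, ((hX.eigenvalues i : ℝ) : ℂ) =
      ∑ i, (((if hX.eigenvalues i ^ 2 = 4 then hX.eigenvalues i else 0 : ℝ)) : ℂ) := by
    rw [← sub_eq_zero, ← Finset.sum_sub_distrib, ← htr0]
    refine Finset.sum_congr rfl fun i _ => ?_
    rw [hp_eval]
    split_ifs <;> push_cast <;> ring
  rw [hsum]
  have hcase : ∀ i, ((if hX.eigenvalues i ^ 2 = 4 then hX.eigenvalues i else 0 : ℝ) : ℂ) =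
      2 * (if hX.eigenvalues i = 2 then (1 : ℂ) else 0) - 2 * (if hX.eigenvalues i = -2 then (1 : ℂ) else 0) := by
    intro i
    by_cases h2 : hX.eigenvalues i = 2
    · rw [if_pos (by rw [h2]; norm_num), if_pos h2, if_neg (by rw [h2]; norm_num), h2]; push_cast; ring
    · by_cases h2' : hX.eigenvalues i = -2
      · rw [if_pos (by rw [h2']; norm_num), if_neg h2, if_pos h2', h2']; push_cast; ring
      · have : hX.eigenvalues i ^ 2 ≠ 4 := by
          intro h4
          have : (hX.eigenvalues i - 2) * (hX.eigenvalues i + 2) = 0 := by nlinarith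
          rcases mul_eq_zero.mp this with h | h
          · exact h2 (by linarith)
          · exact h2' (by linarith)
        rw [if_neg this, if_neg h2, if_neg h2']; push_cast; ring
  simp_rw [hcase, Finset.sum_sub_distrib, ← Finset.mul_sum, Finset.sum_boole]

/-- **The extreme eigenspaces of `X = Γ − ε`**: for `σ = ±1`, `ker (X − 2σ) = ker (1 + Γε) ⊓ ker (Γ − σ)`
(on `ker D₀ = ker(Γ + ε)` one has `X = 2Γ`; conversely `Xψ = 2σψ` forces `Γψ = σψ`, `εψ = −σψ` by the norm identity
`‖(Γ−σ)ψ‖² + ‖(ε+σ)ψ‖² = Re⟨ψ, (4 − 2σX)ψ⟩ = 0`). [folklore] -/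
theorem ker_involution_diff_eq {Γ ε : Matrix n n ℂ} (hΓ : Γᴴ = Γ) (hΓ2 : Γ * Γ = 1) (hε : εᴴ = ε)
    (hε2 : ε * ε = 1) {σ : ℝ} (hσ1 : σ = 1 ∨ σ = -1) :
    LinearMap.ker (Γ - ε - ((2 * σ : ℝ) : ℂ) • (1 : Matrix n n ℂ)).mulVecLin =
      LinearMap.ker (1 + Γ * ε).mulVecLin ⊓ LinearMap.ker (Γ - ((σ : ℝ) : ℂ) • (1 : Matrix n n ℂ)).mulVecLin := by
  have hσ : σ ^ 2 = 1 := by rcases hσ1 with h | h <;> rw [h] <;> norm_num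
  ext ψ
  simp only [LinearMap.mem_ker, Submodule.mem_inf, Matrix.mulVecLin_apply, Matrix.sub_mulVec,
    Matrix.add_mulVec, Matrix.one_mulVec, Matrix.smul_mulVec, ← Matrix.mulVec_mulVec]
  constructor
  · intro h
    -- `X ψ = 2σ ψ`
    have hX : Γ *ᵥ ψ - ε *ᵥ ψ = ((2 * σ : ℝ) : ℂ) • ψ := by
      rw [sub_eq_zero] at h; exact h
    -- the norm identity
    have hq := re_star_dotProduct_conjTranspose_mul_self_mulVec (Γ - ((σ : ℝ) : ℂ) • (1 : Matrix n n ℂ)) ψ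
    have hq' := re_star_dotProduct_conjTranspose_mul_self_mulVec (ε + ((σ : ℝ) : ℂ) • (1 : Matrix n n ℂ)) ψ
    have hM : (Γ - ((σ : ℝ) : ℂ) • (1 : Matrix n n ℂ))ᴴ * (Γ - ((σ : ℝ) : ℂ) • (1 : Matrix n n ℂ)) +
        (ε + ((σ : ℝ) : ℂ) • (1 : Matrix n n ℂ))ᴴ * (ε + ((σ : ℝ) : ℂ) • (1 : Matrix n n ℂ)) =
        (4 : ℂ) • (1 : Matrix n n ℂ) - ((2 * σ : ℝ) : ℂ) • (Γ - ε) := by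
      have hσc : ((σ : ℝ) : ℂ) * ((σ : ℝ) : ℂ) = 1 := by
        rw [← Complex.ofReal_mul, ← sq, hσ, Complex.ofReal_one]
      rw [conjTranspose_sub, conjTranspose_add, conjTranspose_smul, conjTranspose_one,
        hΓ, hε, Complex.star_def, Complex.conj_ofReal]
      simp only [Matrix.sub_mul, Matrix.mul_sub, Matrix.add_mul, Matrix.mul_add, Matrix.smul_mul,
        Matrix.mul_smul, Matrix.one_mul, Matrix.mul_one, hΓ2, hε2]
      rcases hσ1 with h1 | h1 <;> simp only [h1] <;> push_cast <;> module
    have hsum : (∑ j, ‖((Γ - ((σ : ℝ) : ℂ) • (1 : Matrix n n ℂ)) *ᵥ ψ) j‖ ^ 2) +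
        ∑ j, ‖((ε + ((σ : ℝ) : ℂ) • (1 : Matrix n n ℂ)) *ᵥ ψ) j‖ ^ 2 = 0 := by
      rw [← hq, ← hq', ← map_add, ← dotProduct_add, ← Matrix.add_mulVec, hM, Matrix.sub_mulVec,
        Matrix.smul_mulVec, Matrix.smul_mulVec, Matrix.one_mulVec, Matrix.sub_mulVec, hX, smul_smul]
      have : ((2 * σ : ℝ) : ℂ) * ((2 * σ : ℝ) : ℂ) = 4 := by
        rw [← Complex.ofReal_mul, show (2 * σ) * (2 * σ) = 4 * σ ^ 2 by ring, hσ]; norm_num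
      rw [this, sub_self, dotProduct_zero, map_zero]
    have h1 : ∑ j, ‖((Γ - ((σ : ℝ) : ℂ) • (1 : Matrix n n ℂ)) *ᵥ ψ) j‖ ^ 2 = 0 := by
      have ha := Finset.sum_nonneg (fun j (_ : j ∈ Finset.univ) =>
        (sq_nonneg ‖((Γ - ((σ : ℝ) : ℂ) • (1 : Matrix n n ℂ)) *ᵥ ψ) j‖))
      have hb := Finset.sum_nonneg (fun j (_ : j ∈ Finset.univ) =>
        (sq_nonneg ‖((ε + ((σ : ℝ) : ℂ) • (1 : Matrix n n ℂ)) *ᵥ ψ) j‖))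
      linarith
    have h2 : ∑ j, ‖((ε + ((σ : ℝ) : ℂ) • (1 : Matrix n n ℂ)) *ᵥ ψ) j‖ ^ 2 = 0 := by linarith
    have hΓψ : (Γ - ((σ : ℝ) : ℂ) • (1 : Matrix n n ℂ)) *ᵥ ψ = 0 := by
      funext j
      have := (Finset.sum_eq_zero_iff_of_nonneg (fun j _ => sq_nonneg _)).mp h1 j (Finset.mem_univ j)
      exact norm_eq_zero.mp (pow_eq_zero_iff two_ne_zero |>.mp this)
    have hεψ : (ε + ((σ : ℝ) : ℂ) • (1 : Matrix n n ℂ)) *ᵥ ψ = 0 := by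
      funext j
      have := (Finset.sum_eq_zero_iff_of_nonneg (fun j _ => sq_nonneg _)).mp h2 j (Finset.mem_univ j)
      exact norm_eq_zero.mp (pow_eq_zero_iff two_ne_zero |>.mp this)
    rw [Matrix.sub_mulVec, Matrix.smul_mulVec, Matrix.one_mulVec, sub_eq_zero] at hΓψ
    rw [Matrix.add_mulVec, Matrix.smul_mulVec, Matrix.one_mulVec, add_eq_zero_iff_eq_neg] at hεψ
    refine ⟨?_, ?_⟩
    · -- D₀ ψ = ψ + Γ (ε ψ) = ψ − σ Γ ψ = ψ − σ² ψ = 0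
      rw [hεψ, Matrix.mulVec_neg, Matrix.mulVec_smul, hΓψ, smul_smul, ← Complex.ofReal_mul, ← sq, hσ,
        Complex.ofReal_one, one_smul, add_neg_cancel]
    · rw [hΓψ, sub_self]
  · rintro ⟨hD, hΓψ⟩
    rw [sub_eq_zero] at hΓψ
    -- from `ψ + Γ ε ψ = 0`: `Γ ψ + ε ψ = 0`
    have hY : Γ *ᵥ ψ + ε *ᵥ ψ = 0 := by
      have := congrArg (fun w => Γ *ᵥ w) hD
      simp only [Matrix.mulVec_add, Matrix.mulVec_mulVec, Matrix.mulVec_zero] at this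
      rw [← Matrix.mul_assoc, hΓ2, Matrix.one_mul] at this
      exact this
    have hεψ : ε *ᵥ ψ = -(Γ *ᵥ ψ) := eq_neg_of_add_eq_zero_right hY
    rw [hεψ, hΓψ, sub_neg_eq_add, ← add_smul, sub_eq_zero]
    push_cast
    ring_nf

/-- **The lattice index theorem in matrix form** (Hasenfratz–Laliena–Niedermayer 1998; Lüscher 1998): for Hermitian
involutions `Γ` ("`γ₅`") and `ε` ("`sign H`") and the Ginsparg–Wilson operator `D₀ = 1 + Γε`,
`Tr Γ(1 − ½D₀) = n₊ − n₋`, where `n_± = dim (ker D₀ ∩ ker(Γ ∓ 1))` count the zero modes of `D₀` of chirality `±1`.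
[cite: HasenfratzLalienaNiedermayer1998, eq. (11) (index theorem)] -/
theorem trace_mul_one_sub_half_ginspargWilson_eq_index {Γ ε : Matrix n n ℂ} (hΓ : Γᴴ = Γ) (hΓ2 : Γ * Γ = 1)
    (hε : εᴴ = ε) (hε2 : ε * ε = 1) :
    (Γ * (1 - (2⁻¹ : ℂ) • (1 + Γ * ε))).trace =
      (Module.finrank ℂ ↥(LinearMap.ker (1 + Γ * ε).mulVecLin ⊓ LinearMap.ker (Γ - 1).mulVecLin) : ℂ) -
      (Module.finrank ℂ ↥(LinearMap.ker (1 + Γ * ε).mulVecLin ⊓ LinearMap.ker (Γ + 1).mulVecLin) : ℂ) := by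
  -- Γ(1 − ½(1 + Γε)) = ½(Γ − ε)
  have halg : Γ * (1 - (2⁻¹ : ℂ) • (1 + Γ * ε)) = (2⁻¹ : ℂ) • (Γ - ε) := by
    rw [smul_add, Matrix.mul_sub, Matrix.mul_add, Matrix.mul_one, Matrix.mul_smul, Matrix.mul_one,
      Matrix.mul_smul, ← Matrix.mul_assoc, hΓ2, Matrix.one_mul]
    module
  rw [halg, Matrix.trace_smul, trace_sub_eq_of_involutions hΓ hΓ2 hε hε2]
  have k1 := ker_involution_diff_eq hΓ hΓ2 hε hε2 (σ := 1) (Or.inl rfl)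
  have k2 := ker_involution_diff_eq hΓ hΓ2 hε hε2 (σ := -1) (Or.inr rfl)
  rw [show ((2 * (1 : ℝ) : ℝ) : ℂ) = ((2 : ℝ) : ℂ) by norm_num,
    show ((1 : ℝ) : ℂ) • (1 : Matrix n n ℂ) = 1 by simp] at k1
  rw [show ((2 * (-1 : ℝ) : ℝ) : ℂ) = ((-2 : ℝ) : ℂ) by norm_num,
    show Γ - ((-1 : ℝ) : ℂ) • (1 : Matrix n n ℂ) = Γ + 1 by simp] at k2
  rw [k1, k2]
  simp only [smul_eq_mul]
  ring

end Abstract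

/-! ### The index theorem for the overlap operator -/

section Overlap

variable {L N : ℕ} [NeZero L] {G : Type*} [Group G] (ρ : G →* Matrix (Fin N) (Fin N) ℂ)

/-- **The index theorem for Neuberger's overlap operator** (Hasenfratz–Laliena–Niedermayer 1998, Lüscher 1998):
off the exceptional set `det H = 0`, the massless overlap operator `D₀ = 1 + Γ₅ ε(H)` on the periodic lattice satisfies
`Tr Γ₅(1 − ½D₀) = n₊ − n₋`, `n_± = dim {ψ | D₀ψ = 0, Γ₅ψ = ±ψ}`. [cite: HasenfratzLalienaNiedermayer1998, eq. (11) (index theorem)] -/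
theorem overlap_index_theorem (hρ : ∀ g, ρ g ∈ Matrix.unitaryGroup (Fin N) ℂ) (U : GaugeConfig 4 L G) (m₀ : ℝ)
    (hdet : (overlapKernel ρ U m₀).det ≠ 0) :
    (spinorLift gammaFive * (1 - (2⁻¹ : ℂ) • overlapDirac ρ U m₀ 0)).trace =
      (Module.finrank ℂ ↥(LinearMap.ker (overlapDirac ρ U m₀ 0).mulVecLin ⊓
          LinearMap.ker (spinorLift gammaFive - 1 :
            Matrix (TorusSite 4 L × Fin N × Fin 4) (TorusSite 4 L × Fin N × Fin 4) ℂ).mulVecLin) : ℂ) -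
      (Module.finrank ℂ ↥(LinearMap.ker (overlapDirac ρ U m₀ 0).mulVecLin ⊓
          LinearMap.ker (spinorLift gammaFive + 1 :
            Matrix (TorusSite 4 L × Fin N × Fin 4) (TorusSite 4 L × Fin N × Fin 4) ℂ).mulVecLin) : ℂ) := by
  rw [overlapDirac_zero]
  exact trace_mul_one_sub_half_ginspargWilson_eq_index (spinorLift_gammaFive_conjTranspose (L := L) (N := N))
    spinorLift_gammaFive_mul_self (isHermitian_overlapSign ρ U m₀).eq (overlapSign_mul_self ρ hρ U m₀ hdet)

/-- **Index = spectral asymmetry**: combining with `trace_gammaFive_mul_one_sub_half_overlapDirac_zero`,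
`n₊ − n₋ = N₋(H) − ½ dim` (Fujiwara 2002 (2.2): `index D = −½ Tr(H/√H²)`). [cite: Fujiwara2002SpectralFlow, eq. (2.2)] -/
theorem overlap_index_eq_countP_neg_sub_half (hρ : ∀ g, ρ g ∈ Matrix.unitaryGroup (Fin N) ℂ)
    (U : GaugeConfig 4 L G) (m₀ : ℝ) (hdet : (overlapKernel ρ U m₀).det ≠ 0) :
    (Module.finrank ℂ ↥(LinearMap.ker (overlapDirac ρ U m₀ 0).mulVecLin ⊓
          LinearMap.ker (spinorLift gammaFive - 1 :
            Matrix (TorusSite 4 L × Fin N × Fin 4) (TorusSite 4 L × Fin N × Fin 4) ℂ).mulVecLin) : ℂ) -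
      (Module.finrank ℂ ↥(LinearMap.ker (overlapDirac ρ U m₀ 0).mulVecLin ⊓
          LinearMap.ker (spinorLift gammaFive + 1 :
            Matrix (TorusSite 4 L × Fin N × Fin 4) (TorusSite 4 L × Fin N × Fin 4) ℂ).mulVecLin) : ℂ) =
      ((overlapKernel ρ U m₀).charpoly.roots.countP (fun z : ℂ => z.re < 0) : ℂ) -
        (Fintype.card (TorusSite 4 L × Fin N × Fin 4) : ℂ) / 2 := by
  rw [← overlap_index_theorem ρ hρ U m₀ hdet, trace_gammaFive_mul_one_sub_half_overlapDirac_zero ρ hρ U m₀ hdet]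

end Overlap



end Literature.MathematicalPhysics.QuantumLattice

end
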